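import Literature.IUT.HodgeTheaters.TemperedCoveringsCor23KerLevelOfHPrime
import Literature.IUT.HodgeTheaters.TemperedCoveringsSlimnessLemmas
import HarnessLib

/-!
# Input (y) «`N_i ≠ 1`» of the (H′) route to [IUTchI] Cor. 2.3 (iii)'s KER-LEVEL, from the printed per-vertex inputs at ONE
# vertex per tower level (row «KER-LEVEL-VIA-HPRIME», GAP-LEDGER G-w4d052-g6-3 reduced)

Mochizuki, *Inter-universal Teichmüller theory I: construction of Hodge theaters*, kurims manuscript (May 2020), §2,
Cor. 2.3 (iii), proof p. 48 l. 44 – p. 49 l. 5 ("Write `J_v ⊆ J` for the decomposition group [well-defined up to conjugation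
in `J`] associated to `v` … the image of the
homomorphism `J_v ⊆ J ⊆ Δ̂_X ↠ Π̂_𝔾` is pro-`Σ`; … the maximal pro-`l` quotient … of `J_v` … [is] the pro-`l` completion of
the fundamental group of a hyperbolic Riemann surface, hence … nonabelian") [cite: Mochizuki2012, Cor 2.3(iii) pp.48-49]
(D-0012 claim key; series status DISPUTED; nothing of the series is asserted here); Mochizuki, *Semi-graphs of anabelioids*,
Publ. RIMS **42** (2006), Ex. 3.10 pp. 44–45 [cite: MochizukiSemiAnbd2006, Ex 3.10 pp.44-45].

PROOF-ONLY (abc-iut cell; seat abc-iut-w4-d052 gen 6; L5-lead BOOKING 02:08Z «(y)»).  The (H′) route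
(`TemperedCoveringsCor23KerLevelOfHPrime.lean`, p485924) derives the KER-LEVEL laws `hA`/`hB` from (x) a free pro-`Σ′`
structure on `Δ̂_X`, (z) `Σ′` unbounded and (y) «`N_i := (Ĵ_i ∩ Δ̂_X) ∩ Ker(Δ̂_X ↠ Π̂_𝔾) ≠ 1` at every level».  HERE (y) is
DERIVED from a SUBSET of print's per-vertex inputs of the (iii) argument (abc-iut-w4-d058/w4-d070's list in
`mem_level_of_comm_ker_of_inputs`), at ONE vertex `v` of the level-`i` dual graph: its decomposition group `J_v ≤ Ĵ_i ∩ Δ̂_X`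
(closed), a prime `l ∉ Σ`, a continuous surjection `J_v ↠ L` onto a NON-TRIVIAL pro-`l` group (print: the nonabelian maximal
pro-`l` quotient), and «the image of `J_v` in `Π̂_𝔾` is pro-`Σ`» (`hSigv`, p. 48 l. 62) — by abc-iut-w4-d070's kernel lemma
`map_eq_top_of_proSigma_of_proL` («`Ker(J_v → Π̂_𝔾)` maps ONTO `L`»): a non-trivial element of `L` lifts to a non-trivial
element of `J_v ∩ Ker(Δ̂_X ↠ Π̂_𝔾) ⊆ N_i`.  NOT needed (versus print's route): (A3), the [SemiAnbd] Cor. 3.11 inertia step,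
`(J*)^{ab}`, unipotence, [Config] Prop. 1.4.

* `inf_ker_ne_bot_of_proSigma_of_proL` — generic, one level;
* `inf_ker_ne_bot_towerLevels_of_inputs` — every level of a `Prop24Tower`;
* `cor23_i_to_v_ofSpecialFibre_closureH_of_piData_of_mem_decompSubgroups_of_hPrime_of_inputs` — the Cor. 2.3 (i)–(v) block at
  the record's `ℍ` with `hA`, `hB` discharged and (y) replaced by the per-vertex inputs (side conditions `Δ̂_X` closed,
  `ρ̂` continuous, `Π̂_𝔾` Hausdorff DISCHARGED at the genuine datum).

BINDER CENSUS of the (i)–(v) headline: DATA = `X`, `d`, `S`, `Σ`/`Σ̂` + side conditions, `TpH`, `hTpH`, `cuspMeetsH`, `T`, `P`,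
(z) `hSig` · DATUM-INTERNAL = `h36`, `S.hyp`, origin `hind : P.ActGraphInduces` · FACT-INSTANCE = `hcoh`; IN SHAPE (x) `hΓ`/`hι`
(GAP G-w4d052-g6-2) · PER-LEVEL PRINT INPUTS (the currency of GAP G-w4d058-1, ONE vertex per level `i`): `Jv`, `hJvJ`, `hJvc`,
`hl : l ∉ Σ`, `L`, `ql`, `hqlc`, `hqls`, `hLl : IsProSigma {l} (L i)`, `hLnt : L i ≠ 1`, `hSigv` · LAW = none beyond these.
Model-RELATIVE; typed ≠ discharged; no definition, no instance, no new `Prop` fact; nothing here bears on [IUTchIII] Cor. 3.12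
or asserts that abc is proved or refuted.
-/

noncomputable section

namespace Literature.IUT.HodgeTheaters

open _root_.Topology
open scoped Pointwise
open Literature.AnabelianGeometry.SemiGraphs
open Literature.AnabelianGeometry.SemiGraphs.SemiGraphOfAnabelioids (IsProSigmaCompletion)

namespace StableCurveTemperedData

universe u

/-! ### A. One level: `J ∩ Ker(Δ̂_X ↠ Π̂_𝔾) ≠ 1` from one vertex's decomposition group -/

section Generic

variable (D : StableCurveTemperedData.{u})

/-- **(y) at ONE level from ONE vertex**: if `J_v ≤ J` is closed, `l ∉ Σ`, `J_v ↠ L` is a continuous surjection onto a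
non-trivial pro-`l` group, and the image of `J_v` in `Π̂_𝔾` is pro-`Σ` (`hSigv`), then `J ∩ Ker(Δ̂_X ↠ Π̂_𝔾) ≠ 1`:
`Ker(J_v → Π̂_𝔾)` maps ONTO `L` (abc-iut-w4-d070's `map_eq_top_of_proSigma_of_proL`), so a non-trivial element of `L` lifts
to a non-trivial element of `J_v ∩ Ker`. [cite: Mochizuki2012, Cor 2.3(iii) pp.48-49] -/
theorem inf_ker_ne_bot_of_proSigma_of_proL (hΔc : IsClosed (D.DeltaHat : Set D.PiHat)) [T2Space D.graph.Hat]
    (hρc : Continuous D.ρHat) (J : Subgroup D.DeltaHat) (Jv : Subgroup D.DeltaHat) (hJvJ : Jv ≤ J)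
    (hJvc : IsClosed (Jv : Set D.DeltaHat)) {l : ℕ} (hl : l ∉ D.graph.Sigma)
    {L : Type*} [Group L] [TopologicalSpace L] [IsTopologicalGroup L] [CompactSpace L] [TotallyDisconnectedSpace L]
    (ql : Jv →* L) (hqlc : Continuous ql) (hqls : Function.Surjective ql) (hLl : IsProSigma {l} L)
    (hLnt : ∃ y : L, y ≠ 1)
    (hSigv : ∀ M : Subgroup Jv, M.Normal → IsOpen (M : Set Jv) → (D.ρHat.ker).subgroupOf Jv ≤ M →
      ∀ q : ℕ, q.Prime → q ∣ M.index → q ∈ D.graph.Sigma) :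
    J ⊓ D.ρHat.ker ≠ ⊥ := by
  haveI : CompactSpace D.DeltaHat := isCompact_iff_compactSpace.mp hΔc.isCompact
  haveI : CompactSpace Jv := isCompact_iff_compactSpace.mp hJvc.isCompact
  -- `Ker(Δ̂_X ↠ Π̂_𝔾)` is closed, so `Ker ∩ J_v` is compact and its image under `ql` is closed
  have hkc : IsClosed ((D.ρHat.ker : Subgroup D.DeltaHat) : Set D.DeltaHat) := by
    have e : ((D.ρHat.ker : Subgroup D.DeltaHat) : Set D.DeltaHat) = D.ρHat ⁻¹' {1} := by
      ext x; exact MonoidHom.mem_ker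
    rw [e]
    exact isClosed_singleton.preimage hρc
  have hN : ((D.ρHat.ker).subgroupOf Jv).map ql = ⊤ := by
    refine map_eq_top_of_proSigma_of_proL hl _ hSigv ql hqlc hqls hLl ?_
    rw [Subgroup.coe_map]
    exact (((hkc.preimage continuous_subtype_val).isCompact).image hqlc).isClosed
  -- lift a non-trivial element of `L`
  obtain ⟨y, hy⟩ := hLnt
  have hymem : y ∈ ((D.ρHat.ker).subgroupOf Jv).map ql := by rw [hN]; exact Subgroup.mem_top y
  obtain ⟨h, hh, hhy⟩ := Subgroup.mem_map.mp hymem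
  intro hbot
  have hmem : (h : D.DeltaHat) ∈ J ⊓ D.ρHat.ker := ⟨hJvJ h.2, hh⟩
  rw [hbot, Subgroup.mem_bot] at hmem
  have h1 : h = 1 := Subtype.ext hmem
  exact hy (by rw [← hhy, h1, map_one])

end Generic

/-! ### B. Every level of a tower: the binder (y) of the (H′) route from per-vertex inputs -/

section Tower

variable (D : StableCurveTemperedData.{u}) (T : D.Prop24Tower)

/-- **(y) at every tower level** from ONE vertex per level with its decomposition group `J_v ≤ Ĵ_i ∩ Δ̂_X`, a continuous
surjection onto a non-trivial pro-`l` group (`l ∉ Σ`), and the pro-`Σ` image condition. [cite: Mochizuki2012, Cor 2.3(iii) pp.48-49] -/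
theorem inf_ker_ne_bot_towerLevels_of_inputs (hΔc : IsClosed (D.DeltaHat : Set D.PiHat)) [T2Space D.graph.Hat]
    (hρc : Continuous D.ρHat) (Jv : T.I → Subgroup D.DeltaHat) (hJvJ : ∀ i, Jv i ≤ (T.Jhat i).subgroupOf D.DeltaHat)
    (hJvc : ∀ i, IsClosed (Jv i : Set D.DeltaHat)) {l : ℕ} (hl : l ∉ D.graph.Sigma)
    (L : T.I → Type*) [∀ i, Group (L i)] [∀ i, TopologicalSpace (L i)] [∀ i, IsTopologicalGroup (L i)]
    [∀ i, CompactSpace (L i)] [∀ i, TotallyDisconnectedSpace (L i)]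
    (ql : ∀ i, Jv i →* L i) (hqlc : ∀ i, Continuous (ql i)) (hqls : ∀ i, Function.Surjective (ql i))
    (hLl : ∀ i, IsProSigma {l} (L i)) (hLnt : ∀ i, ∃ y : L i, y ≠ 1)
    (hSigv : ∀ i (M : Subgroup (Jv i)), M.Normal → IsOpen (M : Set (Jv i)) →
      (D.ρHat.ker).subgroupOf (Jv i) ≤ M → ∀ q : ℕ, q.Prime → q ∣ M.index → q ∈ D.graph.Sigma) :
    ∀ i, (T.Jhat i).subgroupOf D.DeltaHat ⊓ D.ρHat.ker ≠ ⊥ :=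
  fun i => D.inf_ker_ne_bot_of_proSigma_of_proL hΔc hρc _ (Jv i) (hJvJ i) (hJvc i) hl (ql i) (hqlc i) (hqls i)
    (hLl i) (hLnt i) (hSigv i)

end Tower

/-! ### C. Cor. 2.3 (i)–(v) at the record's `ℍ` via (H′) with (y) from the per-vertex inputs -/

section Block

variable {p : ℕ} [Fact p.Prime] (X : TemperedCurve p) (d : X.GroupLevelData)
  (S : SpecialFibreData (X.toTemperedArithmeticGroup d)) (h36 : S.Gc.Prop36Hypotheses)
  (Sigma SigmaHat : Set ℕ) (hsub : Sigma ⊆ SigmaHat) (hne : Sigma.Nonempty)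
  (hprime : ∀ q ∈ SigmaHat, q.Prime) (hp : p ∉ Sigma)
  (TpH : Subgroup S.chart.G)
  (cuspMeetsH : {x : X.Pt // X.IsCusp x} → Prop)
  (T : SpecialFibreTower X.DeltaTemp)

/-- **[IUTchI] Cor. 2.3 (i)–(v) AS TYPED at the genuine datum for the record's `ℍ := P.H`, every
`Π^tp_ℍ ∈ decompSubgroups S.chart P.H`, (H′) route with (y) DISCHARGED from the per-vertex print inputs** (one vertex per
level: `Jv`, `hJvJ`, `hJvc`, `l ∉ Σ`, `L`, `ql`, `hqlc`, `hqls`, `hLl`, `hLnt`, `hSigv`); remaining: origin datum `hind`, the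
FACT-INSTANCE `hcoh`, (x) `hΓ`/`hι`, (z) `hSig`; side conditions `Δ̂_X` closed / `ρ̂` continuous / `Π̂_𝔾` Hausdorff discharged
by abc-iut-L5's `ofSpecialFibre_isClosed_deltaHat` / `_continuous_ρHat` / `_t2Space_graphHat`.
[cite: Mochizuki2012, Cor 2.3 pp.47-50] -/
theorem cor23_i_to_v_ofSpecialFibre_closureH_of_piData_of_mem_decompSubgroups_of_hPrime_of_inputs
    (P : SpecialFibreTower.PiData X d S T) (hcoh : S.Gc.IsCoherent) (hTpH : TpH ∈ S.chart.decompSubgroups P.H)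
    (hind : P.ActGraphInduces)
    {Γ : Type*} [Group Γ] [IsFreeGroup Γ] (hΓ : ∃ x y : Γ, x * y ≠ y * x) {Sig : Set ℕ}
    {ι : Γ →* (ofSpecialFibre X d S h36 Sigma SigmaHat hsub hne hprime hp TpH
      ((TpH.map (TemperedGraphGroupData.exists_completion_of_prop36 S.Gc h36
        S.chart).choose_spec.choose.toMonoidHom).topologicalClosure) (Subgroup.le_topologicalClosure _) cuspMeetsH).DeltaHat}
    (hι : IsProSigmaCompletion Sig ι) (hSig : ∀ m : ℕ, ∃ q ∈ Sig, q.Prime ∧ m < q)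
    (Jv : ℕ → Subgroup (ofSpecialFibre X d S h36 Sigma SigmaHat hsub hne hprime hp TpH
      ((TpH.map (TemperedGraphGroupData.exists_completion_of_prop36 S.Gc h36
        S.chart).choose_spec.choose.toMonoidHom).topologicalClosure) (Subgroup.le_topologicalClosure _) cuspMeetsH).DeltaHat)
    (hJvJ : ∀ i, Jv i ≤ ((OfSpecialFibre.towerOfSpecialFibreTower X d T Sigma SigmaHat hsub hne hprime S h36 hp TpH
        ((TpH.map (TemperedGraphGroupData.exists_completion_of_prop36 S.Gc h36
        S.chart).choose_spec.choose.toMonoidHom).topologicalClosure) (Subgroup.le_topologicalClosure _)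
        cuspMeetsH).Jhat i).subgroupOf
        (ofSpecialFibre X d S h36 Sigma SigmaHat hsub hne hprime hp TpH
      ((TpH.map (TemperedGraphGroupData.exists_completion_of_prop36 S.Gc h36
        S.chart).choose_spec.choose.toMonoidHom).topologicalClosure) (Subgroup.le_topologicalClosure _) cuspMeetsH).DeltaHat)
    (hJvc : ∀ i, IsClosed (Jv i : Set (ofSpecialFibre X d S h36 Sigma SigmaHat hsub hne hprime hp TpH
      ((TpH.map (TemperedGraphGroupData.exists_completion_of_prop36 S.Gc h36
        S.chart).choose_spec.choose.toMonoidHom).topologicalClosure) (Subgroup.le_topologicalClosure _) cuspMeetsH).DeltaHat))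
    {l : ℕ} (hl : l ∉ Sigma)
    (L : ℕ → Type*) [∀ i, Group (L i)] [∀ i, TopologicalSpace (L i)] [∀ i, IsTopologicalGroup (L i)]
    [∀ i, CompactSpace (L i)] [∀ i, TotallyDisconnectedSpace (L i)]
    (ql : ∀ i, Jv i →* L i) (hqlc : ∀ i, Continuous (ql i)) (hqls : ∀ i, Function.Surjective (ql i))
    (hLl : ∀ i, IsProSigma {l} (L i)) (hLnt : ∀ i, ∃ y : L i, y ≠ 1)
    (hSigv : ∀ i (M : Subgroup (Jv i)), M.Normal → IsOpen (M : Set (Jv i)) →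
      ((ofSpecialFibre X d S h36 Sigma SigmaHat hsub hne hprime hp TpH
      ((TpH.map (TemperedGraphGroupData.exists_completion_of_prop36 S.Gc h36
        S.chart).choose_spec.choose.toMonoidHom).topologicalClosure) (Subgroup.le_topologicalClosure _) cuspMeetsH).ρHat.ker).subgroupOf (Jv i) ≤ M →
      ∀ q : ℕ, q.Prime → q ∣ M.index → q ∈ Sigma) :
    ((ofSpecialFibre X d S h36 Sigma SigmaHat hsub hne hprime hp TpH
      ((TpH.map (TemperedGraphGroupData.exists_completion_of_prop36 S.Gc h36
        S.chart).choose_spec.choose.toMonoidHom).topologicalClosure) (Subgroup.le_topologicalClosure _) cuspMeetsH).Cor23i ∧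
      (ofSpecialFibre X d S h36 Sigma SigmaHat hsub hne hprime hp TpH
      ((TpH.map (TemperedGraphGroupData.exists_completion_of_prop36 S.Gc h36
        S.chart).choose_spec.choose.toMonoidHom).topologicalClosure) (Subgroup.le_topologicalClosure _) cuspMeetsH).Cor23ii ∧
      (ofSpecialFibre X d S h36 Sigma SigmaHat hsub hne hprime hp TpH
      ((TpH.map (TemperedGraphGroupData.exists_completion_of_prop36 S.Gc h36
        S.chart).choose_spec.choose.toMonoidHom).topologicalClosure) (Subgroup.le_topologicalClosure _) cuspMeetsH).Cor23iii ∧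
      (ofSpecialFibre X d S h36 Sigma SigmaHat hsub hne hprime hp TpH
      ((TpH.map (TemperedGraphGroupData.exists_completion_of_prop36 S.Gc h36
        S.chart).choose_spec.choose.toMonoidHom).topologicalClosure) (Subgroup.le_topologicalClosure _) cuspMeetsH).Cor23iv) ∧
      (ofSpecialFibre X d S h36 Sigma SigmaHat hsub hne hprime hp TpH
      ((TpH.map (TemperedGraphGroupData.exists_completion_of_prop36 S.Gc h36
        S.chart).choose_spec.choose.toMonoidHom).topologicalClosure) (Subgroup.le_topologicalClosure _) cuspMeetsH).Cor23v :=
  haveI := ofSpecialFibre_t2Space_graphHat X d S h36 Sigma SigmaHat hsub hne hprime hp TpH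
    ((TpH.map (TemperedGraphGroupData.exists_completion_of_prop36 S.Gc h36
      S.chart).choose_spec.choose.toMonoidHom).topologicalClosure) (Subgroup.le_topologicalClosure _) cuspMeetsH
  cor23_i_to_v_ofSpecialFibre_closureH_of_piData_of_mem_decompSubgroups_of_hPrime X d S h36 Sigma SigmaHat hsub hne hprime
    hp TpH cuspMeetsH T P hcoh hTpH hind hΓ hι hSig
    (inf_ker_ne_bot_towerLevels_of_inputs _ _
      (ofSpecialFibre_isClosed_deltaHat X d S h36 Sigma SigmaHat hsub hne hprime hp TpH _ _ cuspMeetsH)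
      (ofSpecialFibre_continuous_ρHat X d S h36 Sigma SigmaHat hsub hne hprime hp TpH _ _ cuspMeetsH)
      Jv hJvJ hJvc hl L ql hqlc hqls hLl hLnt hSigv)

end Block

end StableCurveTemperedData

end Literature.IUT.HodgeTheaters

end
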